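import Summits.Ventures.PercRepro2.CaseOneA2Edge

/-!
# The Q-threshold forms along an `a₂a₃`-edge: the identities and the four-functions bound
(blind cell PercRepro2, p1 g30; the sign facts and the theorems are in `CaseOneA2EdgeQ.lean`)

Along an `a₂a₃`-edge `e₂` of weight `r` the Q-pair of `G` is the `r`-mixture of the Q-pair of
`G − e₂` and the Q-pair of the graph with `e₂` forced open (`Dqo_pin`), and so is the `b`-pair; the
cleared `(ii-Q)` is `(1 − r)` times a QUADRATIC in `r` whose three Bernstein coefficients are
`Λ(c⁰, y⁰) = (ii-Q)(G − e₂)`, `Λ(c⁰, y¹) + Λ(c¹, y⁰)` and `Λ(c¹, y¹)`, where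
`Λ(c, y) = c₁ (y₁ P₄ − y₀ P₃) − c₀ (y₁ P₂ − y₀ P₁)` is the `(ii)` form of `G − e₂` at the `o`-pair `c`
and the `b`-pair `y` (**`iiExprQ_a2_edge`**). The coefficient `Λ(c⁰, y¹)` is `≥ 0` by the `b`-threshold
monotonicity (`a2_bThreshold_nonneg`) and the Q-odds lemma `odds_q` (**`lamQ_c0_y1_nonneg`**). The
coefficients with the forced-open `o`-pair `c¹ = (P₁(Q, o ∈ U), P₁(Q))` are `≥ 0` as soon as `c¹` has
at least the PD-threshold of `G − e₂`:

  **(ODDS-3E)**  `D₀ₒ · P₁(Q) ≤ P₁(Q, o ∈ U) · D₀`,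

because `D₀ · Λ(c¹, y) = P₁(Q) · Λ(PD₀, y) − (D₀ P₁(Q, o ∈ U) − D₀ₒ P₁(Q)) · (y₁ P₂ − y₀ P₁)` with
`Λ(PD₀, y) ≥ 0` (`(ii)(G − e₂)` at `y⁰`, the mixed term `a2MixII_nonneg` at `y¹`) and
`y₁ P₂ − y₀ P₁ ≤ 0` (BHK 1.4) (**`lamQ_c1_nonneg`**); when `D₀ = 0` the four functions theorem gives
`P₀(Q, a₃ ∈ C₁) · P₀(Q, a₃ ∈ C₂) ≤ D₀ = 0` (**`pT1_mul_pT_le_Dpd`**), so either every `a₃`-mass or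
the whole forced-open pair vanishes. Hence **`zSplitIIQ_of_a2_edge`**: ODDS-3E ∧ `(ii)(G − e₂)` ∧
`(ii-Q)(G − e₂)` ⟹ `(ii-Q)(G)`, and its mirror **`zSplitIQ_of_a2_edge`** (BHK 1.3, the `b ∈ C₁`
pair `(R₁, X₁) = (R₀ − R₂, X₀ − P₁)`), whence **`fourForms_of_a2_edge`**: ODDS-3E ∧ the four forms of
`G − e₂` ⟹ the four forms of `G`. ODDS-3E (`γ_PD ≤ P(o ↔ {a₁, a₂, a₃} ∣ a₁ ↮ {a₂, a₃})`) is a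
HYPOTHESIS here — census-true (proofs/P1-G30.md §2), not a theorem. Own code; standard axioms.
-/

namespace Summit.Ventures.PercRepro2

namespace CaseOne

/-! ## The pinned Q-pair and the four-functions bound on the PD mass -/

section QPin
variable {V : Type*} {E : Type*} [Fintype E] [DecidableEq E] {R : Type*} [CommRing R]
variable {ends : E → Sym2 V} {a₁ a₂ a₃ : V} {e₂ : E}

/-- `P(Q, o ∈ U)` is the `r`-mixture of its forced-closed and forced-open versions. -/
lemma Dqo_pin (p : E → R) (e₂ : E) (o : V) :
    Dqo p ends o a₁ a₂ = p e₂ * Dqo (Function.update p e₂ 1) ends o a₁ a₂ +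
      (1 - p e₂) * Dqo (Function.update p e₂ 0) ends o a₁ a₂ := by
  unfold Dqo
  exact prob_eq_pin p _ e₂

/-- **The Q-threshold `(ii)` along an `a₂a₃`-edge**: `(1 − r)` times a quadratic in `r` whose
Bernstein coefficients are the `(ii)` forms of `G − e₂` at the four pairs of `o`- and `b`-pairs. -/
theorem iiExprQ_a2_edge (p : E → R) (he : ends e₂ = s(a₂, a₃)) (o b : V) :
    iiExprT p ends o a₁ a₂ a₃ b (Dqo p ends o a₁ a₂) (prob p (connEvent ends a₁ a₂)ᶜ) =
      (1 - p e₂) *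
        ((1 - p e₂) ^ 2 *
            iiExprT (Function.update p e₂ 0) ends o a₁ a₂ a₃ b
              (Dqo (Function.update p e₂ 0) ends o a₁ a₂)
              (prob (Function.update p e₂ 0) (connEvent ends a₁ a₂)ᶜ) +
          p e₂ * (1 - p e₂) *
            ((prob (Function.update p e₂ 0) (connEvent ends a₁ a₂)ᶜ *
                (prob (Function.update p e₂ 1) (connEvent ends a₁ a₂)ᶜ *
                  prob (Function.update p e₂ 0) (connEvent ends a₂ b ∩ connEvent ends a₁ a₃ ∩
                    connEvent ends a₂ o ∩ (connEvent ends a₁ a₂)ᶜ) -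
                prob (Function.update p e₂ 1) (connEvent ends a₂ b ∩ (connEvent ends a₁ a₂)ᶜ) *
                  prob (Function.update p e₂ 0) (connEvent ends a₁ a₃ ∩ connEvent ends a₂ o ∩
                    (connEvent ends a₁ a₂)ᶜ)) -
              Dqo (Function.update p e₂ 0) ends o a₁ a₂ *
                (prob (Function.update p e₂ 1) (connEvent ends a₁ a₂)ᶜ *
                  prob (Function.update p e₂ 0) (connEvent ends a₂ b ∩ connEvent ends a₁ a₃ ∩
                    (connEvent ends a₁ a₂)ᶜ) -
                prob (Function.update p e₂ 1) (connEvent ends a₂ b ∩ (connEvent ends a₁ a₂)ᶜ) *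
                  prob (Function.update p e₂ 0) (connEvent ends a₁ a₃ ∩ (connEvent ends a₁ a₂)ᶜ))) +
            (prob (Function.update p e₂ 1) (connEvent ends a₁ a₂)ᶜ *
                (prob (Function.update p e₂ 0) (connEvent ends a₁ a₂)ᶜ *
                  prob (Function.update p e₂ 0) (connEvent ends a₂ b ∩ connEvent ends a₁ a₃ ∩
                    connEvent ends a₂ o ∩ (connEvent ends a₁ a₂)ᶜ) -
                prob (Function.update p e₂ 0) (connEvent ends a₂ b ∩ (connEvent ends a₁ a₂)ᶜ) *
                  prob (Function.update p e₂ 0) (connEvent ends a₁ a₃ ∩ connEvent ends a₂ o ∩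
                    (connEvent ends a₁ a₂)ᶜ)) -
              Dqo (Function.update p e₂ 1) ends o a₁ a₂ *
                (prob (Function.update p e₂ 0) (connEvent ends a₁ a₂)ᶜ *
                  prob (Function.update p e₂ 0) (connEvent ends a₂ b ∩ connEvent ends a₁ a₃ ∩
                    (connEvent ends a₁ a₂)ᶜ) -
                prob (Function.update p e₂ 0) (connEvent ends a₂ b ∩ (connEvent ends a₁ a₂)ᶜ) *
                  prob (Function.update p e₂ 0) (connEvent ends a₁ a₃ ∩ (connEvent ends a₁ a₂)ᶜ)))) +
          p e₂ ^ 2 *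
            (prob (Function.update p e₂ 1) (connEvent ends a₁ a₂)ᶜ *
                (prob (Function.update p e₂ 1) (connEvent ends a₁ a₂)ᶜ *
                  prob (Function.update p e₂ 0) (connEvent ends a₂ b ∩ connEvent ends a₁ a₃ ∩
                    connEvent ends a₂ o ∩ (connEvent ends a₁ a₂)ᶜ) -
                prob (Function.update p e₂ 1) (connEvent ends a₂ b ∩ (connEvent ends a₁ a₂)ᶜ) *
                  prob (Function.update p e₂ 0) (connEvent ends a₁ a₃ ∩ connEvent ends a₂ o ∩
                    (connEvent ends a₁ a₂)ᶜ)) -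
              Dqo (Function.update p e₂ 1) ends o a₁ a₂ *
                (prob (Function.update p e₂ 1) (connEvent ends a₁ a₂)ᶜ *
                  prob (Function.update p e₂ 0) (connEvent ends a₂ b ∩ connEvent ends a₁ a₃ ∩
                    (connEvent ends a₁ a₂)ᶜ) -
                prob (Function.update p e₂ 1) (connEvent ends a₂ b ∩ (connEvent ends a₁ a₂)ᶜ) *
                  prob (Function.update p e₂ 0) (connEvent ends a₁ a₃ ∩ (connEvent ends a₁ a₂)ᶜ)))) := by
  rw [iiExprT_eq, iiExprT_eq, Dqo_pin p e₂ o,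
    prob_a2_edge_of_subset_AQ p he (Y := connEvent ends a₂ b ∩ connEvent ends a₁ a₃ ∩
      connEvent ends a₂ o ∩ (connEvent ends a₁ a₂)ᶜ) (fun _ h => ⟨h.1.1.2, h.2⟩),
    prob_a2_edge_of_subset_AQ p he (Y := connEvent ends a₁ a₃ ∩ connEvent ends a₂ o ∩
      (connEvent ends a₁ a₂)ᶜ) (fun _ h => ⟨h.1.1, h.2⟩),
    prob_a2_edge_of_subset_AQ p he (Y := connEvent ends a₂ b ∩ connEvent ends a₁ a₃ ∩
      (connEvent ends a₁ a₂)ᶜ) (fun _ h => ⟨h.1.2, h.2⟩),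
    prob_a2_edge_of_subset_AQ p he (Y := connEvent ends a₁ a₃ ∩ (connEvent ends a₁ a₂)ᶜ)
      (fun _ h => h),
    prob_eq_pin p (connEvent ends a₁ a₂)ᶜ e₂,
    prob_eq_pin p (connEvent ends a₂ b ∩ (connEvent ends a₁ a₂)ᶜ) e₂]
  ring

/-- **The Q-threshold `(i)` along an `a₂a₃`-edge** (the mirror identity). -/
theorem iExprQ_a2_edge (p : E → R) (he : ends e₂ = s(a₂, a₃)) (o b : V) :
    iExprT p ends o a₁ a₂ a₃ b (Dqo p ends o a₁ a₂) (prob p (connEvent ends a₁ a₂)ᶜ) =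
      (1 - p e₂) *
        ((1 - p e₂) ^ 2 *
            iExprT (Function.update p e₂ 0) ends o a₁ a₂ a₃ b
              (Dqo (Function.update p e₂ 0) ends o a₁ a₂)
              (prob (Function.update p e₂ 0) (connEvent ends a₁ a₂)ᶜ) +
          p e₂ * (1 - p e₂) *
            ((-(prob (Function.update p e₂ 0) (connEvent ends a₁ a₂)ᶜ *
                (prob (Function.update p e₂ 1) (connEvent ends a₁ a₂)ᶜ *
                  prob (Function.update p e₂ 0) (connEvent ends a₁ b ∩ connEvent ends a₁ a₃ ∩
                    connEvent ends a₂ o ∩ (connEvent ends a₁ a₂)ᶜ) -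
                prob (Function.update p e₂ 1) (connEvent ends a₁ b ∩ (connEvent ends a₁ a₂)ᶜ) *
                  prob (Function.update p e₂ 0) (connEvent ends a₁ a₃ ∩ connEvent ends a₂ o ∩
                    (connEvent ends a₁ a₂)ᶜ))) +
              Dqo (Function.update p e₂ 0) ends o a₁ a₂ *
                (prob (Function.update p e₂ 1) (connEvent ends a₁ a₂)ᶜ *
                  prob (Function.update p e₂ 0) (connEvent ends a₁ b ∩ connEvent ends a₁ a₃ ∩
                    (connEvent ends a₁ a₂)ᶜ) -
                prob (Function.update p e₂ 1) (connEvent ends a₁ b ∩ (connEvent ends a₁ a₂)ᶜ) *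
                  prob (Function.update p e₂ 0) (connEvent ends a₁ a₃ ∩ (connEvent ends a₁ a₂)ᶜ))) +
            (-(prob (Function.update p e₂ 1) (connEvent ends a₁ a₂)ᶜ *
                (prob (Function.update p e₂ 0) (connEvent ends a₁ a₂)ᶜ *
                  prob (Function.update p e₂ 0) (connEvent ends a₁ b ∩ connEvent ends a₁ a₃ ∩
                    connEvent ends a₂ o ∩ (connEvent ends a₁ a₂)ᶜ) -
                prob (Function.update p e₂ 0) (connEvent ends a₁ b ∩ (connEvent ends a₁ a₂)ᶜ) *
                  prob (Function.update p e₂ 0) (connEvent ends a₁ a₃ ∩ connEvent ends a₂ o ∩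
                    (connEvent ends a₁ a₂)ᶜ))) +
              Dqo (Function.update p e₂ 1) ends o a₁ a₂ *
                (prob (Function.update p e₂ 0) (connEvent ends a₁ a₂)ᶜ *
                  prob (Function.update p e₂ 0) (connEvent ends a₁ b ∩ connEvent ends a₁ a₃ ∩
                    (connEvent ends a₁ a₂)ᶜ) -
                prob (Function.update p e₂ 0) (connEvent ends a₁ b ∩ (connEvent ends a₁ a₂)ᶜ) *
                  prob (Function.update p e₂ 0) (connEvent ends a₁ a₃ ∩ (connEvent ends a₁ a₂)ᶜ)))) +
          p e₂ ^ 2 *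
            (-(prob (Function.update p e₂ 1) (connEvent ends a₁ a₂)ᶜ *
                (prob (Function.update p e₂ 1) (connEvent ends a₁ a₂)ᶜ *
                  prob (Function.update p e₂ 0) (connEvent ends a₁ b ∩ connEvent ends a₁ a₃ ∩
                    connEvent ends a₂ o ∩ (connEvent ends a₁ a₂)ᶜ) -
                prob (Function.update p e₂ 1) (connEvent ends a₁ b ∩ (connEvent ends a₁ a₂)ᶜ) *
                  prob (Function.update p e₂ 0) (connEvent ends a₁ a₃ ∩ connEvent ends a₂ o ∩
                    (connEvent ends a₁ a₂)ᶜ))) +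
              Dqo (Function.update p e₂ 1) ends o a₁ a₂ *
                (prob (Function.update p e₂ 1) (connEvent ends a₁ a₂)ᶜ *
                  prob (Function.update p e₂ 0) (connEvent ends a₁ b ∩ connEvent ends a₁ a₃ ∩
                    (connEvent ends a₁ a₂)ᶜ) -
                prob (Function.update p e₂ 1) (connEvent ends a₁ b ∩ (connEvent ends a₁ a₂)ᶜ) *
                  prob (Function.update p e₂ 0) (connEvent ends a₁ a₃ ∩ (connEvent ends a₁ a₂)ᶜ)))) := by
  rw [iExprT_eq, iExprT_eq, Dqo_pin p e₂ o,
    prob_a2_edge_of_subset_AQ p he (Y := connEvent ends a₁ b ∩ connEvent ends a₁ a₃ ∩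
      connEvent ends a₂ o ∩ (connEvent ends a₁ a₂)ᶜ) (fun _ h => ⟨h.1.1.2, h.2⟩),
    prob_a2_edge_of_subset_AQ p he (Y := connEvent ends a₁ a₃ ∩ connEvent ends a₂ o ∩
      (connEvent ends a₁ a₂)ᶜ) (fun _ h => ⟨h.1.1, h.2⟩),
    prob_a2_edge_of_subset_AQ p he (Y := connEvent ends a₁ b ∩ connEvent ends a₁ a₃ ∩
      (connEvent ends a₁ a₂)ᶜ) (fun _ h => ⟨h.1.2, h.2⟩),
    prob_a2_edge_of_subset_AQ p he (Y := connEvent ends a₁ a₃ ∩ (connEvent ends a₁ a₂)ᶜ)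
      (fun _ h => h),
    prob_eq_pin p (connEvent ends a₁ a₂)ᶜ e₂,
    prob_eq_pin p (connEvent ends a₁ b ∩ (connEvent ends a₁ a₂)ᶜ) e₂]
  ring

end QPin

/-! ## The four functions theorem: `P(Q, a₃ ∈ C₁) · P(Q, a₃ ∈ C₂) ≤ P(PD)` -/

section FourFn
variable {V : Type*} {E : Type*} [Fintype E] [DecidableEq E]
  {R : Type*} [CommRing R] [LinearOrder R] [IsStrictOrderedRing R]
variable {ends : E → Sym2 V} {a₁ a₂ a₃ : V}

omit [Fintype E] [DecidableEq E] in
/-- The meet of a configuration with `a₃ ∈ C₁, Q` and one with `a₃ ∈ C₂, Q` has `a₃` in neither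
cluster (and `Q`). -/
lemma inf_mem_PD {ω ω' : Config E}
    (h : ω ∈ connEvent ends a₁ a₃ ∩ (connEvent ends a₁ a₂)ᶜ)
    (h' : ω' ∈ connEvent ends a₂ a₃ ∩ (connEvent ends a₁ a₂)ᶜ) :
    ω ⊓ ω' ∈ (connEvent ends a₁ a₃)ᶜ ∩ (connEvent ends a₂ a₃)ᶜ ∩ (connEvent ends a₁ a₂)ᶜ := by
  simp only [Set.mem_inter_iff, Set.mem_compl_iff, mem_connEvent] at h h' ⊢
  have hle : ω ⊓ ω' ≤ ω := inf_le_left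
  have hle' : ω ⊓ ω' ≤ ω' := inf_le_right
  refine ⟨⟨fun h13 => ?_, fun h23 => ?_⟩, fun h12 => h.2 (conn_mono hle h12)⟩
  · -- `a₁ ↔ a₃` in the meet gives `a₁ ↔ a₃` in `ω'`, where `a₃ ↔ a₂`: `a₁ ↔ a₂` in `ω'`
    exact h'.2 (conn_trans (conn_mono hle' h13) (conn_symm h'.1))
  · -- `a₂ ↔ a₃` in the meet gives `a₂ ↔ a₃` in `ω`, where `a₁ ↔ a₃`: `a₁ ↔ a₂` in `ω`
    exact h.2 (conn_trans h.1 (conn_symm (conn_mono hle h23)))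

/-- **`P(Q, a₃ ∈ C₁) · P(Q, a₃ ∈ C₂) ≤ D`** (the four functions theorem with `C = univ`). -/
theorem pT1_mul_pT_le_Dpd (p : E → R) (hp : IsProbVec p) :
    prob p (connEvent ends a₁ a₃ ∩ (connEvent ends a₁ a₂)ᶜ) *
        prob p (connEvent ends a₂ a₃ ∩ (connEvent ends a₁ a₂)ᶜ) ≤ Dpd p ends a₁ a₂ a₃ := by
  have h := prob_mul_prob_le_of_sup_inf hp (A := connEvent ends a₁ a₃ ∩ (connEvent ends a₁ a₂)ᶜ)
    (B := connEvent ends a₂ a₃ ∩ (connEvent ends a₁ a₂)ᶜ) (C := Set.univ)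
    (D := (connEvent ends a₁ a₃)ᶜ ∩ (connEvent ends a₂ a₃)ᶜ ∩ (connEvent ends a₁ a₂)ᶜ)
    (fun ω hω ω' hω' => ⟨Set.mem_univ _, inf_mem_PD hω hω'⟩)
  have hu : prob p (Set.univ : Set (Config E)) = 1 := by
    unfold prob
    simp only [Set.indicator_univ]
    exact sum_weight p
  rw [hu, one_mul] at h
  exact h

end FourFn

/-! ## The sign facts for the Bernstein coefficients -/

section Split
variable {V : Type*} {E : Type*} [Fintype E] [DecidableEq E] [Fintype V] [DecidableEq V]
  {R : Type*} [Field R] [LinearOrder R] [IsStrictOrderedRing R]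
variable {ends : E → Sym2 V} {a₁ a₂ a₃ : V} {e₂ : E}

omit [Fintype V] [DecidableEq V] in
/-- `Q ∩ {a₃ ∉ C₁}` splits into `PD` and `Q ∩ {a₃ ∈ C₂}`. -/
lemma prob_Q_notA_eq (p : E → R) :
    prob p ((connEvent ends a₁ a₂)ᶜ ∩ (connEvent ends a₁ a₃)ᶜ) =
      Dpd p ends a₁ a₂ a₃ + prob p (connEvent ends a₂ a₃ ∩ (connEvent ends a₁ a₂)ᶜ) := by
  have e := prob_inter_add_prob_inter_compl p ((connEvent ends a₁ a₂)ᶜ ∩ (connEvent ends a₁ a₃)ᶜ)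
    (connEvent ends a₂ a₃)
  have e1 : (connEvent ends a₁ a₂)ᶜ ∩ (connEvent ends a₁ a₃)ᶜ ∩ connEvent ends a₂ a₃ =
      connEvent ends a₂ a₃ ∩ (connEvent ends a₁ a₂)ᶜ := by
    ext ω
    simp only [Set.mem_inter_iff, Set.mem_compl_iff, mem_connEvent]
    exact ⟨fun h => ⟨h.2, h.1.1⟩, fun h => ⟨⟨h.2, fun h13 => h.2 (conn_trans h13 (conn_symm h.1))⟩,
      h.1⟩⟩
  have e2 : (connEvent ends a₁ a₂)ᶜ ∩ (connEvent ends a₁ a₃)ᶜ ∩ (connEvent ends a₂ a₃)ᶜ =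
      (connEvent ends a₁ a₃)ᶜ ∩ (connEvent ends a₂ a₃)ᶜ ∩ (connEvent ends a₁ a₂)ᶜ := by
    ext ω; simp only [Set.mem_inter_iff]; tauto
  rw [e1, e2] at e
  unfold Dpd
  linear_combination -e

omit [Fintype V] [DecidableEq V] in
/-- `P₁(Q) = D₀ + P₀(Q, a₃ ∈ C₂)`: the forced-open `Q` is `PD` together with `a₃ ∈ C₂`. -/
lemma prob_Q_update_one_eq_Dpd_add (p : E → R) (he : ends e₂ = s(a₂, a₃)) :
    prob (Function.update p e₂ 1) (connEvent ends a₁ a₂)ᶜ =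
      Dpd (Function.update p e₂ 0) ends a₁ a₂ a₃ +
        prob (Function.update p e₂ 0) (connEvent ends a₂ a₃ ∩ (connEvent ends a₁ a₂)ᶜ) := by
  rw [prob_Q_update_one (a₁ := a₁) p he, ← prob_Q_notA_eq]
  have e := prob_inter_add_prob_inter_compl (Function.update p e₂ 0) (connEvent ends a₁ a₂)ᶜ
    (connEvent ends a₁ a₃)
  rw [Set.inter_comm (connEvent ends a₁ a₂)ᶜ (connEvent ends a₁ a₃)] at e
  linarith

end Split

end CaseOne

end Summit.Ventures.PercRepro2
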